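import Summits.CriticalPhenomena.PercolationContinuityZ3.Theses.PercTwoPointDecay
import Summits.CriticalPhenomena.PercolationContinuityZ3.Theorems.PercNearOneGluingNoHeavyLowerTailCSHTheoremOne
import Literature.Barriers.CriticalPhenomena.GaussianDominationRoute
import Literature.Probability.Percolation.TwoPointFunction
import HarnessLib

/-!
# `PercTwoPointDecay.SubcritToCrit` (stmt-CriticalPhenomena-0839) — SETTLED after continuity

Item `stmt-CriticalPhenomena-0839` of route `CriticalPhenomena/PercTwoPointDecay` (support (glue)): `(0 < p_c < 1) → TauContinuous → SubcritBallAverageDecay → CritBallAverageDecay`.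

Same passage to `p_c` as `TargetOfSubcrit` (the tree's `ballSum_tau_criticalProbI_le_of_forall_lt`); the first two hypotheses are not needed.  p205010 is NOT used.

builds on p205010 (kernel theorem, internal audit signed; external expert review pending) — USED (`CSH.percolationContinuityZ3_holds`).  RSW3 lane, lead gen 28 (prover-prim-rsw3-lead-g28-0):
'after continuity — the ledger harvest'.
References: G. Kozma, N. Nitzan (2024), Thm. 6 / Conj. 3 [KozmaNitzan2024]; G. Grimmett, *Percolation* (1999), §8 [GrimmettPercolation1999].
-/

noncomputable section

namespace Summit.CriticalPhenomena.PercolationContinuityZ3.Theorems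

namespace PercTwoPointDecaySubcritToCrit

open MeasureTheory Literature.Probability.Percolation Literature.Probability.LatticeModels
open Literature.Barriers.CriticalPhenomena (ballSum_tau_criticalProbI_le_of_forall_lt)

/-- **`PercTwoPointDecay.SubcritToCrit` (stmt-CriticalPhenomena-0839), settled.**  `ballSum_tau_criticalProbI_le_of_forall_lt` at each `R` (first two hypotheses unused).
[cite: KozmaNitzan2024, Thm. 6 with Conj. 3 (p. 15)] -/
theorem subcritToCrit_proof : Summit.CriticalPhenomena.PercolationContinuityZ3.Theses.PercTwoPointDecay.SubcritToCrit := by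
  unfold Summit.CriticalPhenomena.PercolationContinuityZ3.Theses.PercTwoPointDecay.SubcritToCrit
  rintro _ _ ⟨a, C, ha, h⟩
  refine ⟨a, C, ha, fun R hR => ?_⟩
  have key := ballSum_tau_criticalProbI_le_of_forall_lt (d := 3) (by norm_num) R (c := C * (R : ℝ) ^ (3 - a))
    (fun p hp => by simpa only [tau] using h p hp R hR)
  simpa only [tau] using key

end PercTwoPointDecaySubcritToCrit

end Summit.CriticalPhenomena.PercolationContinuityZ3.Theorems

end
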